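import Summits.BirchSwinnertonDyer.BirchSwinnertonDyer.Theorems.AdditiveKolyvaginRoadRamifiedHabitatSignLawEvenAnyLevel
import Summits.BirchSwinnertonDyer.BirchSwinnertonDyer.Theorems.AdditiveKolyvaginRoadRamifiedHabitatSignLawEvenInert
import HarnessLib

/-!
# Route `AdditiveKolyvaginRoad`, crux KS′ `LevelKolyvaginSystemsAdditive` (stmt-BirchSwinnertonDyer-21396), card `ramified-toric-habitat` —
# ONE INERT prime flips the sign, EVEN habitat discriminant, ANY LEVEL (the Shimura-curve habitat `X^{pq₀}` for arbitrary cofactor `M`)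

Cell `pub/bsd-wall`, width seat `bsd-wall-akr-p2x-w3` g13; `--supports stmt-BirchSwinnertonDyer-21396` (helper). THEOREMS ONLY; no definition,
no named fact, no `sorry`. BSD is not proved by any of this; KS′/KPA′ stay OPEN at `p² ∣ N`.

The even-cofactor counterpart of w2 g12's `…SignLawInertAnyLevel` (odd `d'`): `…SignLawEvenInert` (this seat) treated `M` squarefree; here
`M = N/p²` is ARBITRARY (prime to `p`), the inert prime `q₀` occurring to an ODD power in `M`:

* `jacobiSym_cofactor_natCast_eq_neg_legendreSym_of_one_inert_anyLevel` — `(D'/M) = −(M/p)` (`M = q₀^{v}·M''`, `v` odd, `(D'/q₀) = −(q₀/p)`,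
  `(D'/M'') = (M''/p)` by `…SignLawEven` §1);
* `rootNumber_mul_rootNumber_ramifiedTwist_even_of_one_inert_anyLevel` — `w(E)·w(E^{(d)}) = +(−1/p)·W_p(E)W_p(E^{(p*)})` on the six potentially
  good types `a ∈ {2,3,4,8,9,10}`, via w2 g12's `…pStarTwist_of_localData_anyLevel` and this seat's `…_of_four_dvd_of_pStar_of_jacobi` (`ε = −1`);
  the flipped dichotomy `…_eq_neg_one_of_not_dvd` (`e ∤ p − 1 ⟹ −1`: Shimura curve for the rank-one rows) / `…_eq_one_of_dvd`.

Conditional on the Modularity Theorem and Kellock–Dokchitser's Rem. 2.2 at `p` for `E`, `E^{(p*)}`.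

References: [cite: MurtyMurty1997, Ch. 6 §1] [cite: Rohrlich1993Compositio, Prop. 2(iv)] [cite: KellockDokchitser2023, Rem. 2.2]
[cite: ShemanskeWalling1993, Prop. 5.4].
-/

set_option autoImplicit false
set_option linter.dupNamespace false

noncomputable section

open scoped Classical MatrixGroups NumberTheorySymbols

open CongruenceSubgroup IsDedekindDomain IsDedekindDomain.HeightOneSpectrum NumberField Rat.HeightOneSpectrum
  WeierstrassCurve Literature.NumberTheory.EllipticCurves Literature.NumberTheory.EllipticCurves.ModularForms
  IsDiscreteValuationRing

namespace Summit.BirchSwinnertonDyer.BirchSwinnertonDyer.Theorems.AdditiveKoly.RamifiedHabitat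

section EvenInertAnyLevel

variable {p : ℕ} [Fact p.Prime]

/-- `(D'/M) = −(M/p)` for ANY odd `M ≠ 0` when exactly ONE prime `q₀ ∣ M`, occurring to an ODD power, is INERT in `ℚ(√d)` (`d = p*·D'`) and every
other prime of `M` splits: `M = q₀^{v}·M''` with `q₀ ∤ M''`, `(D'/q₀)^{v} = (−(q₀/p))^{v} = −(q₀/p)^{v}`, `(D'/M'') = (M''/p)`. [folklore] -/
theorem jacobiSym_cofactor_natCast_eq_neg_legendreSym_of_one_inert_anyLevel (hp2 : p ≠ 2) {D' : ℤ} {M : ℕ} (hM0 : M ≠ 0)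
    (hM2 : ¬ 2 ∣ M) {q₀ : ℕ} (hq₀ : q₀ ∈ M.primeFactors) (hodd₀ : Odd (M.factorization q₀))
    (hinert : J((-1 : ℤ) ^ (p / 2) * p * D' | q₀) = -1)
    (hodd : ∀ q ∈ M.primeFactors, q ≠ q₀ → q ≠ 2 → J((-1 : ℤ) ^ (p / 2) * p * D' | q) = 1) :
    J(D' | M) = -legendreSym p M := by
  have hq₀p : q₀.Prime := Nat.prime_of_mem_primeFactors hq₀
  haveI := Fact.mk hq₀p
  have hq₀2 : q₀ ≠ 2 := fun h ↦ hM2 (h ▸ Nat.dvd_of_mem_primeFactors hq₀)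
  have hdecomp : ordProj[q₀] M * ordCompl[q₀] M = M := Nat.ordProj_mul_ordCompl_eq_self M q₀
  have hM''0 : ordCompl[q₀] M ≠ 0 := (Nat.ordCompl_pos q₀ hM0).ne'
  have hq₀M'' : ¬ q₀ ∣ ordCompl[q₀] M := Nat.not_dvd_ordCompl hq₀p hM0
  have hM''2 : ¬ 2 ∣ ordCompl[q₀] M := fun h ↦ hM2 (h.trans (Nat.ordCompl_dvd M q₀))
  have hsplit'' : ∀ q ∈ (ordCompl[q₀] M).primeFactors, q ≠ 2 → J((-1 : ℤ) ^ (p / 2) * p * D' | q) = 1 := fun q hq hq2 ↦ by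
    obtain ⟨hqp, hqd, -⟩ := Nat.mem_primeFactors.mp hq
    refine hodd q (Nat.mem_primeFactors.mpr ⟨hqp, hqd.trans (Nat.ordCompl_dvd M q₀), hM0⟩) ?_ hq2
    rintro rfl
    exact hq₀M'' hqd
  rw [← hdecomp, jacobiSym.mul_right' D' (pow_ne_zero _ hq₀p.ne_zero) hM''0, Nat.cast_mul, legendreSym.mul, jacobiSym.pow_right,
    jacobiSym_cofactor_eq_neg_legendreSym_of_inert_odd hp2 hq₀2 hinert,
    jacobiSym_cofactor_natCast_eq_legendreSym_of_split hp2 hM''0 hM''2 hsplit'', hodd₀.neg_pow, Nat.cast_pow,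
    ← legendreSym.hom_apply p (q₀ : ℤ), ← map_pow, legendreSym.hom_apply]
  ring

omit [Fact p.Prime] in
/-- `M` is odd when `(D', M p²) = 1` and `4 ∣ D'`. [folklore] -/
private theorem not_two_dvd_of_gcd' {D' : ℤ} {M : ℕ} (h4 : 4 ∣ D') (hgcd : Int.gcd D' (M * p ^ 2 : ℕ) = 1) : ¬ 2 ∣ M := by
  intro h2M
  have hcop : Nat.Coprime D'.natAbs (M * p ^ 2) := by
    have h := hgcd
    simp only [Int.gcd, Int.natAbs_natCast] at h
    exact h
  have h2D : 2 ∣ D'.natAbs := by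
    have h := Int.natAbs_dvd_natAbs.mpr (dvd_trans (⟨2, by norm_num⟩ : (2 : ℤ) ∣ 4) h4)
    simpa using h
  have h1 : (2 : ℕ) ∣ 1 := by
    rw [← hcop.gcd_eq_one]
    exact Nat.dvd_gcd h2D (h2M.mul_right _)
  omega

/-- **ONE INERT PRIME FLIPS THE SIGN, even habitat discriminant, ANY LEVEL.** `W/ℚ` elliptic of conductor `N = M·p²` (`p ≥ 5`, `p ∤ M`, `M`
ARBITRARY), additive potentially good at `p` of type II/III/IV/IV*/III*/II* (`a = ord_pΔ_min ∈ {2,3,4,8,9,10}`); `d = p*·D'` with `D' = 4m` an even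
fundamental discriminant prime to `N`, `d < 0`, exactly one prime `q₀ ∣ M` of ODD exponent INERT in `ℚ(√d)` and every other prime of `M` split. Then
`w(E)·w(E^{(d)}) = +(−1/p)·W_p(E)W_p(E^{(p*)})` — the opposite of the all-split habitat (card T3: Shimura curve `X^{pq₀}`). Conditional on {hmod, F1 at `p`}.
[cite: MurtyMurty1997, Ch. 6 §1] [cite: Rohrlich1993Compositio, Prop. 2(iv)] [cite: KellockDokchitser2023, Rem. 2.2] [cite: ShemanskeWalling1993, Prop. 5.4] -/
theorem rootNumber_mul_rootNumber_ramifiedTwist_even_of_one_inert_anyLevel (W : WeierstrassCurve ℚ) [W.IsElliptic]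
    (hmod : exists_isNewformOf) (hF1 : W.atkinLehnerEigenvalueAt_eq_localRootNumberAt)
    (hF1' : (W.quadraticTwist (((-1 : ℤ) ^ (p / 2) * p : ℤ) : ℚ)).atkinLehnerEigenvalueAt_eq_localRootNumberAt)
    (hp5 : 5 ≤ p) {M : ℕ} (hN : W.conductorNorm ℤ = M * p ^ 2) (hpM : ¬ p ∣ M) {a : ℕ}
    (hΔ : addVal ℤ_[p] (((W.baseChange ℚ_[p]).minimal ℤ_[p]).integralModel ℤ_[p]).Δ = a)
    (ha : a = 2 ∨ a = 3 ∨ a = 4 ∨ a = 8 ∨ a = 9 ∨ a = 10)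
    (hc₄ : addVal ℤ_[p] (((W.baseChange ℚ_[p]).minimal ℤ_[p]).integralModel ℤ_[p]).c₄ ≠ 0)
    (hj : ¬ 3 * addVal ℤ_[p] (((W.baseChange ℚ_[p]).minimal ℤ_[p]).integralModel ℤ_[p]).c₄ <
      addVal ℤ_[p] (((W.baseChange ℚ_[p]).minimal ℤ_[p]).integralModel ℤ_[p]).Δ)
    {D' : ℤ} (h4 : 4 ∣ D') (hm4 : D' / 4 % 4 = 2 ∨ D' / 4 % 4 = 3) (hsq : Squarefree (D' / 4))
    (hgcd : Int.gcd D' (W.conductorNorm ℤ) = 1) (hneg : (-1 : ℤ) ^ (p / 2) * p * D' < 0)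
    {q₀ : ℕ} (hq₀ : q₀ ∈ M.primeFactors) (hodd₀ : Odd (M.factorization q₀))
    (hinert : J((-1 : ℤ) ^ (p / 2) * p * D' | q₀) = -1)
    (hodd : ∀ q ∈ M.primeFactors, q ≠ q₀ → q ≠ 2 → J((-1 : ℤ) ^ (p / 2) * p * D' | q) = 1) :
    W.rootNumber * (W.quadraticTwist (((-1 : ℤ) ^ (p / 2) * p * D' : ℤ) : ℚ)).rootNumber =
      ZMod.χ₄ p * (if a % 6 = 3 then 1 else ZMod.χ₄ p * (if p % 3 = 1 then 1 else -1)) := by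
  have hp : p.Prime := Fact.out
  have hp2 : p ≠ 2 := by omega
  have hdZ0 : ((-1 : ℤ) ^ (p / 2) * p : ℤ) ≠ 0 :=
    mul_ne_zero (pow_ne_zero _ (by norm_num)) (by exact_mod_cast hp.ne_zero)
  have hd0 : (((((-1 : ℤ) ^ (p / 2) * p : ℤ)) : ℚ)) ≠ 0 := by exact_mod_cast hdZ0
  haveI hE' : (W.quadraticTwist (((-1 : ℤ) ^ (p / 2) * p : ℤ) : ℚ)).IsElliptic := W.isElliptic_quadraticTwist hd0
  have hM0 : M ≠ 0 := fun h ↦ (W.conductorNorm_pos_holds).ne' (by rw [hN, h, zero_mul])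
  obtain ⟨hadd, hadd', hprod⟩ := localRootNumber_mul_pStarTwist_padic_of_mem W hp5 hΔ ha hc₄ hj
  have hA := rootNumber_mul_rootNumber_pStarTwist_of_localData_anyLevel W hmod hF1 hF1' hp5 hN hpM hadd hadd' hprod
  have hN' : (W.quadraticTwist (((-1 : ℤ) ^ (p / 2) * p : ℤ) : ℚ)).conductorNorm ℤ = M * p ^ 2 :=
    (conductorNorm_pStarTwist_eq W hp5 hadd hadd').trans hN
  have hgcd' : Int.gcd D' (M * p ^ 2 : ℕ) = 1 := by rw [← hN]; exact hgcd
  have hM2 : ¬ 2 ∣ M := not_two_dvd_of_gcd' h4 hgcd'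
  have hJ : J(D' | M) = (-1) * legendreSym p M := by
    rw [jacobiSym_cofactor_natCast_eq_neg_legendreSym_of_one_inert_anyLevel hp2 hM0 hM2 hq₀ hodd₀ hinert hodd, neg_one_mul]
  rw [rootNumber_mul_rootNumber_ramifiedTwist_of_four_dvd_of_pStar_of_jacobi W hmod hp2 hpM hN' hA h4 hm4 hsq hgcd' hneg hJ,
    jacobiSym_cofactor_prime_sq_eq_one hgcd']
  ring

/-- **SHIMURA-CURVE HABITAT, even `D'`, ANY LEVEL: supercuspidal type, one multiplicative prime of odd exponent inert ⟹ sign `−1`**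
(`e = 12/gcd(12,a) ∤ p − 1`). Conditional on {hmod, F1 at `p`}; BSD is not proved by this.
[cite: Rohrlich1993Compositio, Prop. 2(iv)] [cite: KellockDokchitser2023, Rem. 2.2] -/
theorem rootNumber_mul_rootNumber_ramifiedTwist_even_of_one_inert_anyLevel_eq_neg_one_of_not_dvd (W : WeierstrassCurve ℚ)
    [W.IsElliptic] (hmod : exists_isNewformOf) (hF1 : W.atkinLehnerEigenvalueAt_eq_localRootNumberAt)
    (hF1' : (W.quadraticTwist (((-1 : ℤ) ^ (p / 2) * p : ℤ) : ℚ)).atkinLehnerEigenvalueAt_eq_localRootNumberAt)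
    (hp5 : 5 ≤ p) {M : ℕ} (hN : W.conductorNorm ℤ = M * p ^ 2) (hpM : ¬ p ∣ M) {a : ℕ}
    (hΔ : addVal ℤ_[p] (((W.baseChange ℚ_[p]).minimal ℤ_[p]).integralModel ℤ_[p]).Δ = a)
    (ha : a = 2 ∨ a = 3 ∨ a = 4 ∨ a = 8 ∨ a = 9 ∨ a = 10)
    (hc₄ : addVal ℤ_[p] (((W.baseChange ℚ_[p]).minimal ℤ_[p]).integralModel ℤ_[p]).c₄ ≠ 0)
    (hj : ¬ 3 * addVal ℤ_[p] (((W.baseChange ℚ_[p]).minimal ℤ_[p]).integralModel ℤ_[p]).c₄ <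
      addVal ℤ_[p] (((W.baseChange ℚ_[p]).minimal ℤ_[p]).integralModel ℤ_[p]).Δ)
    {D' : ℤ} (h4 : 4 ∣ D') (hm4 : D' / 4 % 4 = 2 ∨ D' / 4 % 4 = 3) (hsq : Squarefree (D' / 4))
    (hgcd : Int.gcd D' (W.conductorNorm ℤ) = 1) (hneg : (-1 : ℤ) ^ (p / 2) * p * D' < 0)
    {q₀ : ℕ} (hq₀ : q₀ ∈ M.primeFactors) (hodd₀ : Odd (M.factorization q₀))
    (hinert : J((-1 : ℤ) ^ (p / 2) * p * D' | q₀) = -1)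
    (hodd : ∀ q ∈ M.primeFactors, q ≠ q₀ → q ≠ 2 → J((-1 : ℤ) ^ (p / 2) * p * D' | q) = 1)
    (hsc : ¬ 12 / Nat.gcd a 12 ∣ p - 1) :
    W.rootNumber * (W.quadraticTwist (((-1 : ℤ) ^ (p / 2) * p * D' : ℤ) : ℚ)).rootNumber = -1 := by
  have hp2 : p ≠ 2 := by omega
  rw [rootNumber_mul_rootNumber_ramifiedTwist_even_of_one_inert_anyLevel W hmod hF1 hF1' hp5 hN hpM hΔ ha hc₄ hj h4 hm4 hsq hgcd hneg
    hq₀ hodd₀ hinert hodd]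
  have hp' := (Nat.Prime.eq_two_or_odd (Fact.out : p.Prime)).resolve_left hp2
  have hχ₄ := χ₄_natCast_mul_self hp2
  by_cases h6 : a % 6 = 3
  · have e4 : 12 / Nat.gcd a 12 = 4 := by
      rcases ha with rfl | rfl | rfl | rfl | rfl | rfl <;> simp_all
    rw [e4] at hsc
    have h4' : p % 4 = 3 := by omega
    rw [if_pos h6, mul_one, ZMod.χ₄_nat_three_mod_four h4']
  · have h3 : p % 3 ≠ 1 := by
      intro h3
      rcases ha with rfl | rfl | rfl | rfl | rfl | rfl <;> simp_all <;> omega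
    rw [if_neg h6, if_neg h3, ← mul_assoc, hχ₄]
    norm_num

/-- **… and principal-series type (`e ∣ p − 1`, potentially good), one inert prime of odd exponent, even `D'`, ANY LEVEL ⟹ sign `+1`.**
Conditional on {hmod, F1 at `p`}. [cite: Rohrlich1993Compositio, Prop. 2(iv)] [cite: KellockDokchitser2023, Rem. 2.2] -/
theorem rootNumber_mul_rootNumber_ramifiedTwist_even_of_one_inert_anyLevel_eq_one_of_dvd (W : WeierstrassCurve ℚ)
    [W.IsElliptic] (hmod : exists_isNewformOf) (hF1 : W.atkinLehnerEigenvalueAt_eq_localRootNumberAt)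
    (hF1' : (W.quadraticTwist (((-1 : ℤ) ^ (p / 2) * p : ℤ) : ℚ)).atkinLehnerEigenvalueAt_eq_localRootNumberAt)
    (hp5 : 5 ≤ p) {M : ℕ} (hN : W.conductorNorm ℤ = M * p ^ 2) (hpM : ¬ p ∣ M) {a : ℕ}
    (hΔ : addVal ℤ_[p] (((W.baseChange ℚ_[p]).minimal ℤ_[p]).integralModel ℤ_[p]).Δ = a)
    (ha : a = 2 ∨ a = 3 ∨ a = 4 ∨ a = 8 ∨ a = 9 ∨ a = 10)
    (hc₄ : addVal ℤ_[p] (((W.baseChange ℚ_[p]).minimal ℤ_[p]).integralModel ℤ_[p]).c₄ ≠ 0)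
    (hj : ¬ 3 * addVal ℤ_[p] (((W.baseChange ℚ_[p]).minimal ℤ_[p]).integralModel ℤ_[p]).c₄ <
      addVal ℤ_[p] (((W.baseChange ℚ_[p]).minimal ℤ_[p]).integralModel ℤ_[p]).Δ)
    {D' : ℤ} (h4 : 4 ∣ D') (hm4 : D' / 4 % 4 = 2 ∨ D' / 4 % 4 = 3) (hsq : Squarefree (D' / 4))
    (hgcd : Int.gcd D' (W.conductorNorm ℤ) = 1) (hneg : (-1 : ℤ) ^ (p / 2) * p * D' < 0)
    {q₀ : ℕ} (hq₀ : q₀ ∈ M.primeFactors) (hodd₀ : Odd (M.factorization q₀))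
    (hinert : J((-1 : ℤ) ^ (p / 2) * p * D' | q₀) = -1)
    (hodd : ∀ q ∈ M.primeFactors, q ≠ q₀ → q ≠ 2 → J((-1 : ℤ) ^ (p / 2) * p * D' | q) = 1)
    (hps : 12 / Nat.gcd a 12 ∣ p - 1) :
    W.rootNumber * (W.quadraticTwist (((-1 : ℤ) ^ (p / 2) * p * D' : ℤ) : ℚ)).rootNumber = 1 := by
  have hp2 : p ≠ 2 := by omega
  rw [rootNumber_mul_rootNumber_ramifiedTwist_even_of_one_inert_anyLevel W hmod hF1 hF1' hp5 hN hpM hΔ ha hc₄ hj h4 hm4 hsq hgcd hneg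
    hq₀ hodd₀ hinert hodd]
  have hp' := (Nat.Prime.eq_two_or_odd (Fact.out : p.Prime)).resolve_left hp2
  have hχ₄ := χ₄_natCast_mul_self hp2
  by_cases h6 : a % 6 = 3
  · have e4 : 12 / Nat.gcd a 12 = 4 := by
      rcases ha with rfl | rfl | rfl | rfl | rfl | rfl <;> simp_all
    rw [e4] at hps
    have h4' : p % 4 = 1 := by omega
    rw [if_pos h6, mul_one, ZMod.χ₄_nat_one_mod_four h4']
  · have h3 : p % 3 = 1 := by
      rcases ha with rfl | rfl | rfl | rfl | rfl | rfl <;> simp_all <;> omega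
    rw [if_neg h6, if_pos h3, ← mul_assoc, hχ₄, one_mul]

end EvenInertAnyLevel

end Summit.BirchSwinnertonDyer.BirchSwinnertonDyer.Theorems.AdditiveKoly.RamifiedHabitat

end
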